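import Literature.Computability.AlgebraicComplexity.TableauPositivity
import Literature.Computability.Complexity.PlethysmStabilityBIP
import Literature.Computability.Complexity.OccurrenceObstructionsHooks
import HarnessLib

/-!
# BIP Thm. 6.2 discharged: an explicit row-rigid content tableau of the hook-like shapes
(Bürgisser–Ikenmeyer–Panova 2019, §7)

Topic `Literature/Computability/Complexity`, conventions of `OccurrenceObstructionsBIP.lean`
(determinant size `m`, parameter `M`, `V = ℂ^{m×m}` with the lexicographic matrix variables
`MatIdx m`, `Ω_m = CplxAlg.orbitClosure (detFormLex ℂ m)`, "λ occurs in `ℂ[Ω_m]`" =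
`HasHighestWeight (detOrbitRep ℂ m) (partitionWeightLex m λ)`, the hook-like shapes
`hookPartition b c i D = b × 1 + c × i + 1 × (D - b - ci)` with rows `hookRows`) and of
`TableauPositivity.lean` (content tableaux `ContentTableau.cellsOf/…`, row rigidity
`CplxAlg.fst_perm_eq_fst`, the pipeline `CplxAlg.exists_wreathInvariant_hwv`).

Source: P. Bürgisser, C. Ikenmeyer, G. Panova, *No occurrence obstructions in geometric complexity
theory*, J. AMS 32 (2019) 163–193 = arXiv:1604.06431v3, §6(b) Thm. 6.2 and §7 (Claim 7.1,
Props. 7.2, 7.3, Proof of Theorem 6.2; pp. 21–23 of the held arXiv text, where the flat numbering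
is Claim 35, Propositions 36, 37). The tree proves BIP Thm. 1.4 from the single named fact
`bip2019_thm_6_2` (`PlethysmStabilityBIP.lean`: `bip2019_no_occurrence_obstructions_of_thm_6_2`),
reduces Thm. 6.2 to the positivity statement Prop. 7.3 (`OccurrenceObstructionsHooks.lean`), and
provides the method of §7 in abstract form (`TableauPositivity.lean`: a row-rigid labelling of
the cells of `μ ⊢ D m` by `D` letters with classes of size `m` gives `a_μ(D[m]) > 0`). This file
supplies the missing explicit tableau and DISCHARGES Thm. 6.2:

* §1 `hookZig`, `hookMul`, `hookK`, `hookI` — the multiplicities of the block labels: BIP's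
  subtableau `T'` ("for each `1 ≤ s ≤ te`, let the label `s` appear in `T'` exactly `s` times and
  only in row `min(ℓ, 2t-ℓ+1)`, where `s ≡ ℓ (mod 2t)`") with all multiplicities DOUBLED
  (`x = 2, 4, …, 2K`, `K = te`, `e = 2E`), so that the block width is the even number
  `i = 2E(2Et + 1)` (twice BIP's `i'`) and every block label has at least two cells below the
  first row. (In the printed `T'` the label `s = 1` occurs once; swapping its cell with the
  first-row cell above it is a respecting bijection of value `-1`, so the printed argument "all
  nonzero summands have the value 1" needs this correction — as recorded in
  `TableauPositivity.lean`; the statement of Prop. 7.3 is not affected by the present file, which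
  proves a variant with a specific `i`.)
* §2 `hookQ`, `hookOff`, `hookP`, `hookCell` — the content tableau as an explicit cell map
  `(label u, copy ν) ↦ cell`: block cells row by row and layer by layer, BIP's first-column labels
  as "hanging" cells `(u + 1, 0)` of the block labels `u < r` (in the same row for `u < t`,
  strictly below the block for `t ≤ u < r`), one first-row cell for each of the `i + 1`
  non-singleton columns, and the singleton cells of the first row dealt out so that every label
  has exactly `n` cells; membership (`hookCell_mem`) and injectivity (`hookCell_injective`).
* §3 the induced labelling (`exists_hookLabelling`, a bijection `[0,d) × [0,n) ≃ cells` by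
  counting), its classes and their singleton / non-singleton parts, and ROW RIGIDITY
  (`rowRigid_hookLabelling`) via the abstract Claim 7.1 `CplxAlg.fst_perm_eq_fst`.
* §4 positivity: `exists_wreathInvariant_hwv_hook` (word model) and `exists_hwv_hookPartition`
  (weight form of the topic, the format of `bip2019_prop_7_3`), for all `d ≥ K + i + 1`,
  `n ≥ 2K + 1` — no reduction to small `n, d` and no lifting (§5) is needed, surplus labels and
  letters being absorbed by singleton cells.
* §5 `bip2019_thm_6_2_holds` — BIP Thm. 6.2 with the parameters of the printed Proof of
  Theorem 6.2 (`r = b-1`, `t = c-1`, `E = ⌊(r-1)/2t⌋ + 1`, `d = 3M⁴`, inner degree `8M²`,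
  `hook_params`: `i ≤ 2M⁴`), the lifting-and-evaluation half being that of the tree's conditional
  `bip2019_thm_6_2_of_prop_7_3`; and `bip2019_prop_6_3_holds` (Prop. 6.3 unconditionally).

With `bip2019_prop_2_4_holds`, `bip2019_prop_6_1_holds` (`PlethysmStabilityBIP.lean`) this makes
the padding-free core of BIP Thm. 1.4 and the barrier entries of
`Literature/Barriers/PneNP/GCTOccurrenceObstructions.lean` unconditional (assembled there, in
`GCTOccurrenceObstructionsProofs.lean`).

## References

* P. Bürgisser, C. Ikenmeyer, G. Panova, *No occurrence obstructions in geometric complexity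
  theory*, J. AMS 32 (2019) = arXiv:1604.06431v3: §4 Thm. 4.7; §5 Lemma 5.2, 5.3, Thm. 5.4;
  §6(b) Thm. 6.2; §7 (7.1), Claim 7.1, Props. 7.2, 7.3 and the Proof of Theorem 6.2; Thm. 2.5,
  Prop. 3.2. [key `BurgisserIkenmeyerPanovaJAMS2019`]

## Mathlib and tree

Mathlib: `Finset.sum_range_add`, `Finset.sum_range_succ`, `Finset.sum_comm`,
`Finset.sum_le_sum_of_subset`, `Finset.card_image_of_injOn`, `Fintype.bijective_iff_injective_and_card`,
`Equiv.ofBijective`, `Nat.div_add_mod`, `YoungDiagram.mem_iff_lt_rowLen`. Tree: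
`hookPartition`/`hookRows` (`antitone_hookRows`, `sum_range_hookRows`, `hookRows_eq_zero`,
`getD_sortedParts_partitionOfRows`, `card_parts_partitionOfRows_le`), `CplxAlg.rowLen_youngDiagram`,
`YoungDiagram.rowLen_eq_of_forall_mem_iff`, `Nat.Partition.card_cells_youngDiagram`,
`CplxAlg.ContentTableau.*`, `CplxAlg.fst_perm_eq_fst`, `CplxAlg.exists_wreathInvariant_hwv`,
`CplxAlg.formOfWord` (`formOfWord_mem_highestWeightSpace`, `formOfWord_ne_zero`,
`isHomogeneous_formOfWord`), `revMatIdx` (`strictAnti_revMatIdx`, `neg_partitionWeightLex_revMatIdx`),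
`partitionWeightLex_hookPartition_add_single`, `CplxAlg.innerLift_mem_highestWeightSpace`,
`CplxAlg.aeval_formCoeff_innerLift`, `CplxAlg.aeval_formCoeff_iterPderiv_X_pow_mul`,
`CplxAlg.exists_aeval_formCoeff_sum_linearFormPow_ne_zero`,
`CplxAlg.X_pow_mul_sum_linearFormPow_mem_orbitClosure_detFormLex`,
`CplxAlg.aeval_formCoeff_eq_zero_of_mem_orbitClosure_detFormLex`,
`CplxAlg.hasHighestWeight_orbitCoordRep_of_not_mem`, `bip2019_prop_6_3_of_parts`,
`bip2019_prop_2_3_holds`. No statement of the tree is changed; the named fact `bip2019_prop_7_3`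
(the printed interval of admissible `i`) is left as it is.
-/

open scoped BigOperators

/-! ### 1. The multiplicities of the block labels (BIP's subtableau `T'`, doubled) -/

namespace Literature.Computability.Complexity

open Finset

section Zigzag

/-- The zigzag renumbering of the block labels `k = q·t + j` (layer `q = k / t`, row `j = k % t` of
the block): the identity on even layers and the row reversal `j ↦ t - 1 - j` on odd layers. This
is the bookkeeping behind BIP's subtableau `T'` ("the row `k` of `T'` contains the `e` different
labels `k, 2t+1-k, 2t+k, 4t+1-k, …, t(e-2)+k, te+1-k`"), which makes all block rows equally long.
[cite: BurgisserIkenmeyerPanovaJAMS2019, Prop. 7.3 (proof)] -/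
def hookZig (t k : ℕ) : ℕ := if (k / t) % 2 = 0 then k else (k / t) * t + (t - 1 - k % t)

/-- The number `x_k = 2 (hookZig k + 1)` of block cells of the block label `k`: over the `K = 2Et`
block labels these are the even numbers `2, 4, …, 2K`, each exactly once — BIP's multiplicities
`1, …, te` of `T'` DOUBLED, so that every block label has at least two cells below the first row
(the printed `T'` has a label of multiplicity one, for which a respecting bijection of value `-1`
exists; remark in `TableauPositivity.lean`). [cite: BurgisserIkenmeyerPanovaJAMS2019, Prop. 7.3
(proof)] -/
def hookMul (t k : ℕ) : ℕ := 2 * (hookZig t k + 1)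

/-- The number `K = 2E·t` of block labels (`2E` layers of `t` labels, one per block row; BIP's `te`
with `e = 2E`). [cite: BurgisserIkenmeyerPanovaJAMS2019, Prop. 7.3 (proof)] -/
def hookK (t E : ℕ) : ℕ := 2 * E * t

/-- The block width `i = 2E (2Et + 1)`: the common length of the `t` block rows (`sum_hookMul_row`);
it is even, and twice BIP's `i' = (te+1) e/2` (doubled multiplicities). [cite:
BurgisserIkenmeyerPanovaJAMS2019, Prop. 7.3 (proof)] -/
def hookI (t E : ℕ) : ℕ := 2 * E * (2 * E * t + 1)

variable {t : ℕ}

/-- The zigzag keeps the layer: `hookZig k / t = k / t`. [cite: BurgisserIkenmeyerPanovaJAMS2019,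
Prop. 7.3 (proof)] -/
theorem hookZig_div (ht : 0 < t) (k : ℕ) : hookZig t k / t = k / t := by
  unfold hookZig
  split_ifs with h
  · rfl
  · rw [Nat.add_comm, Nat.add_mul_div_right _ _ ht, Nat.div_eq_of_lt (by omega), Nat.zero_add]

/-- On odd layers the zigzag reverses the row: `hookZig k % t = t - 1 - k % t`. [cite:
BurgisserIkenmeyerPanovaJAMS2019, Prop. 7.3 (proof)] -/
theorem hookZig_mod_of_odd (ht : 0 < t) {k : ℕ} (h : (k / t) % 2 ≠ 0) : hookZig t k % t = t - 1 - k % t := by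
  unfold hookZig
  rw [if_neg h, Nat.add_comm, Nat.add_mul_mod_self_right, Nat.mod_eq_of_lt (by omega)]

/-- On even layers the zigzag is the identity. [cite: BurgisserIkenmeyerPanovaJAMS2019, Prop. 7.3
(proof)] -/
theorem hookZig_of_even {k : ℕ} (h : (k / t) % 2 = 0) : hookZig t k = k := by
  unfold hookZig; rw [if_pos h]

/-- The zigzag renumbering is injective (layer and row are recovered). [cite:
BurgisserIkenmeyerPanovaJAMS2019, Prop. 7.3 (proof)] -/
theorem hookZig_injective (ht : 0 < t) : Function.Injective (hookZig t) := by
  intro a b hab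
  have hdiv : a / t = b / t := by rw [← hookZig_div ht a, ← hookZig_div ht b, hab]
  by_cases h : (a / t) % 2 = 0
  · have hb : (b / t) % 2 = 0 := hdiv ▸ h
    rwa [hookZig_of_even h, hookZig_of_even hb] at hab
  · have hb : (b / t) % 2 ≠ 0 := hdiv ▸ h
    have hma := hookZig_mod_of_odd ht h
    have hmb := hookZig_mod_of_odd ht hb
    rw [hab] at hma
    have hlt_a := Nat.mod_lt a ht
    have hlt_b := Nat.mod_lt b ht
    have hmod : a % t = b % t := by omega
    rw [← Nat.div_add_mod a t, ← Nat.div_add_mod b t, hdiv, hmod]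

/-- The zigzag preserves every union of full layers `[0, Q t)`. [cite:
BurgisserIkenmeyerPanovaJAMS2019, Prop. 7.3 (proof)] -/
theorem hookZig_lt (ht : 0 < t) {Q k : ℕ} (hk : k < Q * t) : hookZig t k < Q * t := by
  have hq : k / t < Q := (Nat.div_lt_iff_lt_mul ht).mpr hk
  unfold hookZig
  split_ifs with h
  · exact hk
  · have hmod := Nat.mod_lt k ht
    calc k / t * t + (t - 1 - k % t) < k / t * t + t := by omega
      _ = (k / t + 1) * t := by ring
      _ ≤ Q * t := Nat.mul_le_mul_right t hq

/-- The multiplicity of the label of row `j` on the even layer `2α` is `2(2αt + j + 1)`. [cite: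
BurgisserIkenmeyerPanovaJAMS2019, Prop. 7.3 (proof)] -/
theorem hookMul_even_layer (ht : 0 < t) (α j : ℕ) (hj : j < t) :
    hookMul t (2 * α * t + j) = 2 * (2 * α * t + j + 1) := by
  have hdiv : (2 * α * t + j) / t = 2 * α := by
    rw [Nat.add_comm, Nat.add_mul_div_right _ _ ht, Nat.div_eq_of_lt hj, Nat.zero_add]
  unfold hookMul
  rw [hookZig_of_even (by rw [hdiv]; omega)]

/-- The multiplicity of the label of row `j` on the odd layer `2α + 1` is `2(2αt + 2t - j)`. [cite:
BurgisserIkenmeyerPanovaJAMS2019, Prop. 7.3 (proof)] -/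
theorem hookMul_odd_layer (ht : 0 < t) (α j : ℕ) (hj : j < t) :
    hookMul t ((2 * α + 1) * t + j) = 2 * (2 * α * t + 2 * t - j) := by
  have hdiv : ((2 * α + 1) * t + j) / t = 2 * α + 1 := by
    rw [Nat.add_comm, Nat.add_mul_div_right _ _ ht, Nat.div_eq_of_lt hj, Nat.zero_add]
  have hmod : ((2 * α + 1) * t + j) % t = j := by
    rw [Nat.add_comm, Nat.add_mul_mod_self_right, Nat.mod_eq_of_lt hj]
  unfold hookMul hookZig
  rw [if_neg (by rw [hdiv]; omega), hdiv, hmod]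
  have h1 : j ≤ t - 1 := by omega
  have h2 : 1 ≤ t := ht
  have h3 : j ≤ 2 * α * t + 2 * t := le_trans (by omega : j ≤ 2 * t) (Nat.le_add_left _ _)
  zify [h1, h2, h3]
  ring

/-- **All block rows have length `i`**: summed over the `2E` layers, the multiplicities of the labels
of row `j` give `2E(2Et + 1)` for every `j < t` (BIP: "each appearing that many times, adding up
to the row length of `∑_α ((2(α-1)t + k) + (2αt + 1 - k)) = (te+1) e/2 = i`", doubled). [cite:
BurgisserIkenmeyerPanovaJAMS2019, Prop. 7.3 (proof)] -/
theorem sum_hookMul_row (ht : 0 < t) (E j : ℕ) (hj : j < t) :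
    ∑ q ∈ range (2 * E), hookMul t (q * t + j) = hookI t E := by
  induction E with
  | zero => simp [hookI]
  | succ E ih =>
    rw [show 2 * (E + 1) = 2 * E + 1 + 1 by ring, sum_range_succ, sum_range_succ, ih,
      hookMul_even_layer ht E j hj, hookMul_odd_layer ht E j hj]
    unfold hookI
    have h3 : j ≤ 2 * E * t + 2 * t := le_trans (by omega : j ≤ 2 * t) (Nat.le_add_left _ _)
    zify [h3]
    ring

/-- Every block label has at least two block cells. [cite: BurgisserIkenmeyerPanovaJAMS2019, Prop. 7.3
(proof)] -/
theorem two_le_hookMul (k : ℕ) : 2 ≤ hookMul t k := by unfold hookMul; omega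

/-- The multiplicities of the block labels are at most `2K`. [cite: BurgisserIkenmeyerPanovaJAMS2019,
Prop. 7.3 (proof)] -/
theorem hookMul_le (ht : 0 < t) {E k : ℕ} (hk : k < hookK t E) : hookMul t k ≤ 2 * hookK t E := by
  unfold hookK at *
  have := hookZig_lt ht (Q := 2 * E) hk
  unfold hookMul
  omega

/-- The multiplicities of the block labels are even. [cite: BurgisserIkenmeyerPanovaJAMS2019, Prop.
7.3 (proof)] -/
theorem even_hookMul (k : ℕ) : Even (hookMul t k) := ⟨hookZig t k + 1, by unfold hookMul; ring⟩

/-- Summation over `[0, Q t)` layer by layer. [folklore] -/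
theorem sum_range_layers (f : ℕ → ℕ) (Q t : ℕ) :
    ∑ u ∈ range (Q * t), f u = ∑ q ∈ range Q, ∑ j ∈ range t, f (q * t + j) := by
  induction Q with
  | zero => simp
  | succ Q ih => rw [Nat.succ_mul, sum_range_add, ih, sum_range_succ]

/-- The block labels fill the `t × i` block exactly: `∑_{k < K} x_k = t · i`. [cite:
BurgisserIkenmeyerPanovaJAMS2019, Prop. 7.3 (proof)] -/
theorem sum_hookMul (ht : 0 < t) (E : ℕ) : ∑ u ∈ range (hookK t E), hookMul t u = t * hookI t E := by
  unfold hookK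
  rw [sum_range_layers, Finset.sum_comm, Finset.sum_const_nat
    (fun j hj => sum_hookMul_row ht E j (mem_range.mp hj)), Finset.card_range]

end Zigzag

end Literature.Computability.Complexity

/-! ### 2. The content tableau as an explicit cell map -/

namespace Literature.Computability.Complexity

open Finset

section Cells

variable {t r E n d : ℕ}

/-- The number of *structured* (non-singleton) cells of the label `u` among `d` labels: a block label
`u < K` has its `x_u` block cells and, if `u < r`, the hanging cell `(u + 1, 0)` of the first
column; the next `i + 1` labels `K ≤ u ≤ K + i` own one cell each, the cells `(0, u - K)` of the
first row in the non-singleton columns; all further labels have singleton cells only. [cite: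
BurgisserIkenmeyerPanovaJAMS2019, Prop. 7.3 (proof)] -/
def hookQ (t r E u : ℕ) : ℕ :=
  if u < hookK t E then hookMul t u + (if u < r then 1 else 0)
  else if u ≤ hookK t E + hookI t E then 1 else 0

/-- The column offset of the block label `u` inside its block row: the block cells of the labels of
the same row on earlier layers come first. [cite: BurgisserIkenmeyerPanovaJAMS2019, Prop. 7.3
(proof)] -/
def hookOff (t u : ℕ) : ℕ := ∑ q ∈ range (u / t), hookMul t (q * t + u % t)

/-- Prefix sums of the numbers `n - hookQ v` of singleton cells of the labels `v < u` (the singleton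
cells of the first row are dealt out to the labels in order). [cite:
BurgisserIkenmeyerPanovaJAMS2019, Prop. 7.3 (proof)] -/
def hookP (t r E n u : ℕ) : ℕ := ∑ v ∈ range u, (n - hookQ t r E v)

/-- **The content tableau of the hook-like shape, as an explicit cell map.** `hookCell t r E n u ν` is
the cell carrying the `ν`-th copy of the label `u`: for `ν < hookQ u` a structured cell — for a
block label `u < K` its block cells `(u % t + 1, δ + hookOff u + ν)` (`δ = 1` in the rows `≤ r`,
which start with a first-column cell) followed, if `u < r`, by the hanging first-column cell `(u +
1, 0)` (in the same row when `u < t`, strictly below the block when `t ≤ u < r`: BIP's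
first-column labels `te, te-1, …, te-r+1`, which "appear in `T'` and in the first column"); for `K
≤ u ≤ K + i` the first-row cell `(0, u - K)` — and for `ν ≥ hookQ u` the singleton cell `(0, i + 1
+ hookP u + (ν - hookQ u))` of the first row. For `u < d`, `ν < n` this is a bijection onto the
cells of `(r+1) × 1 + (t+1) × i + 1 × j ⊢ d n` (`hookCell_mem`, `hookCell_injective`,
`exists_hookLabelling`). [cite: BurgisserIkenmeyerPanovaJAMS2019, Prop. 7.3 (proof)] -/
def hookCell (t r E n u ν : ℕ) : ℕ × ℕ :=
  if ν < hookQ t r E u then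
    (if u < hookK t E then
      (if ν < hookMul t u then (u % t + 1, (if u % t < r then 1 else 0) + hookOff t u + ν) else (u + 1, 0))
      else (0, u - hookK t E))
  else (0, hookI t E + 1 + hookP t r E n u + (ν - hookQ t r E u))

/-- Structured cells of a block label. [cite: BurgisserIkenmeyerPanovaJAMS2019, Prop. 7.3 (proof)] -/
theorem hookQ_of_lt {u : ℕ} (hu : u < hookK t E) :
    hookQ t r E u = hookMul t u + (if u < r then 1 else 0) := by
  unfold hookQ; rw [if_pos hu]

/-- Structured cells of a first-row label. [cite: BurgisserIkenmeyerPanovaJAMS2019, Prop. 7.3 (proof)] -/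
theorem hookQ_of_ge_of_le {u : ℕ} (hu : hookK t E ≤ u) (hu' : u ≤ hookK t E + hookI t E) :
    hookQ t r E u = 1 := by
  unfold hookQ; rw [if_neg (not_lt.mpr hu), if_pos hu']

/-- The filler labels have no structured cell. [cite: BurgisserIkenmeyerPanovaJAMS2019, Prop. 7.3
(proof)] -/
theorem hookQ_of_gt {u : ℕ} (hu : hookK t E + hookI t E < u) : hookQ t r E u = 0 := by
  unfold hookQ; rw [if_neg (by omega), if_neg (by omega)]

/-- Every label has at most `2K + 1` structured cells. [cite: BurgisserIkenmeyerPanovaJAMS2019, Prop.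
7.3 (proof)] -/
theorem hookQ_le (ht : 0 < t) (u : ℕ) : hookQ t r E u ≤ 2 * hookK t E + 1 := by
  unfold hookQ
  split_ifs with h1 h2
  · have := hookMul_le ht (E := E) h1; omega
  · have := hookMul_le ht (E := E) h1; omega
  · omega
  · omega

/-- A block label has at least two structured cells (BIP Claim 7.1: `|C_u^1| ≤ n - 2`). [cite:
BurgisserIkenmeyerPanovaJAMS2019, Claim 7.1] -/
theorem two_le_hookQ {u : ℕ} (hu : u < hookK t E) : 2 ≤ hookQ t r E u := by
  rw [hookQ_of_lt hu]; have := two_le_hookMul (t := t) u; omega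

/-- The block cells are structured cells. [cite: BurgisserIkenmeyerPanovaJAMS2019, Prop. 7.3 (proof)] -/
theorem hookMul_le_hookQ {u : ℕ} (hu : u < hookK t E) : hookMul t u ≤ hookQ t r E u := by
  rw [hookQ_of_lt hu]; omega

/-- A block label has at most one hanging cell. [cite: BurgisserIkenmeyerPanovaJAMS2019, Prop. 7.3
(proof)] -/
theorem hookQ_le_hookMul_add_one {u : ℕ} (hu : u < hookK t E) : hookQ t r E u ≤ hookMul t u + 1 := by
  rw [hookQ_of_lt hu]; split_ifs <;> omega

/-- The block labels `u < r` have a hanging cell. [cite: BurgisserIkenmeyerPanovaJAMS2019, Prop. 7.3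
(proof)] -/
theorem hookQ_eq_hookMul_add_one {u : ℕ} (hu : u < hookK t E) (hur : u < r) :
    hookQ t r E u = hookMul t u + 1 := by
  rw [hookQ_of_lt hu, if_pos hur]

/-- The block labels `u ≥ r` have no hanging cell. [cite: BurgisserIkenmeyerPanovaJAMS2019, Prop. 7.3
(proof)] -/
theorem hookQ_eq_hookMul {u : ℕ} (hu : u < hookK t E) (hur : r ≤ u) : hookQ t r E u = hookMul t u := by
  rw [hookQ_of_lt hu, if_neg (not_lt.mpr hur), add_zero]

/-- A non-block label has at most one structured cell (BIP Claim 7.1: `|C_u^1| > n - 2` for `u > D`).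
[cite: BurgisserIkenmeyerPanovaJAMS2019, Claim 7.1] -/
theorem hookQ_le_one {u : ℕ} (hu : hookK t E ≤ u) : hookQ t r E u ≤ 1 := by
  unfold hookQ; rw [if_neg (not_lt.mpr hu)]; split_ifs <;> omega

/-- Only the labels `u ≤ K + i` have structured cells. [cite: BurgisserIkenmeyerPanovaJAMS2019, Prop.
7.3 (proof)] -/
theorem le_of_hookQ_pos {u : ℕ} (h : 0 < hookQ t r E u) : u ≤ hookK t E + hookI t E := by
  by_contra hgt
  rw [hookQ_of_gt (not_le.mp hgt)] at h
  exact lt_irrefl 0 h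

/-- Recursion of the prefix sums of singleton cells. [folklore] -/
theorem hookP_succ (u : ℕ) : hookP t r E n (u + 1) = hookP t r E n u + (n - hookQ t r E u) := by
  unfold hookP; rw [sum_range_succ]

/-- The prefix sums of singleton cells are monotone. [folklore] -/
theorem hookP_mono {u v : ℕ} (h : u ≤ v) : hookP t r E n u ≤ hookP t r E n v := by
  unfold hookP
  exact Finset.sum_le_sum_of_subset (range_subset_range.mpr h)

/-- Consecutive blocks of singleton cells are disjoint. [folklore] -/
theorem hookP_succ_le {u v : ℕ} (h : u < v) : hookP t r E n u + (n - hookQ t r E u) ≤ hookP t r E n v := by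
  rw [← hookP_succ]; exact hookP_mono h

/-- **The structured cells are the body of the shape and the non-singleton part of the first row**:
`∑_{u < d} hookQ u = t i + r + (i + 1)` when `r ≤ K` and `K + i + 1 ≤ d`. [cite:
BurgisserIkenmeyerPanovaJAMS2019, Prop. 7.3 (proof)] -/
theorem sum_hookQ (ht : 0 < t) (hr : r ≤ hookK t E) (hd : hookK t E + hookI t E + 1 ≤ d) :
    ∑ u ∈ range d, hookQ t r E u = t * hookI t E + r + (hookI t E + 1) := by
  obtain ⟨d', rfl⟩ := Nat.exists_eq_add_of_le hd
  rw [show hookK t E + hookI t E + 1 + d' = hookK t E + (hookI t E + 1 + d') by ring, sum_range_add]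
  have h1 : ∑ u ∈ range (hookK t E), hookQ t r E u = t * hookI t E + r := by
    have hc : ∀ u ∈ range (hookK t E), hookQ t r E u = hookMul t u + (if u < r then 1 else 0) :=
      fun u hu => hookQ_of_lt (mem_range.mp hu)
    rw [Finset.sum_congr rfl hc, sum_add_distrib, sum_hookMul ht E, Finset.sum_boole, Nat.cast_id]
    congr 1
    rw [show (range (hookK t E)).filter (fun u => u < r) = range r from by
      ext u; simp only [mem_filter, mem_range]; omega]
    exact card_range r
  have h2 : ∑ x ∈ range (hookI t E + 1 + d'), hookQ t r E (hookK t E + x) = hookI t E + 1 := by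
    have hz : ∀ x ∈ range d', hookQ t r E (hookK t E + (hookI t E + 1 + x)) = 0 :=
      fun x _ => hookQ_of_gt (by omega)
    have ho : ∀ x ∈ range (hookI t E + 1), hookQ t r E (hookK t E + x) = 1 :=
      fun x hx => hookQ_of_ge_of_le (Nat.le_add_right _ _) (by have := mem_range.mp hx; omega)
    rw [sum_range_add, Finset.sum_eq_zero hz, add_zero, Finset.sum_congr rfl ho, sum_const, card_range,
      smul_eq_mul, mul_one]
  rw [h1, h2]

/-- **The count of singleton cells**: with `n ≥ 2K + 1` cells per label, the singleton cells and the
structured cells together are the `d n` cells of the shape (`hookP d = d n - (t i + r + i + 1)` =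
the number of singleton columns of the first row). [cite: BurgisserIkenmeyerPanovaJAMS2019, Prop.
7.3 (proof)] -/
theorem hookP_eq (ht : 0 < t) (hr : r ≤ hookK t E) (hd : hookK t E + hookI t E + 1 ≤ d)
    (hn : 2 * hookK t E + 1 ≤ n) :
    hookP t r E n d + (t * hookI t E + r + (hookI t E + 1)) = d * n := by
  have hc : ∀ u ∈ range d, (n - hookQ t r E u) + hookQ t r E u = n :=
    fun u _ => Nat.sub_add_cancel ((hookQ_le ht u).trans hn)
  rw [← sum_hookQ ht hr hd, hookP, ← sum_add_distrib, Finset.sum_congr rfl hc, sum_const, card_range,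
    smul_eq_mul]

/-- Offset plus multiplicity is the next prefix sum of the row. [cite:
BurgisserIkenmeyerPanovaJAMS2019, Prop. 7.3 (proof)] -/
theorem hookOff_add_hookMul (u : ℕ) :
    hookOff t u + hookMul t u = ∑ q ∈ range (u / t + 1), hookMul t (q * t + u % t) := by
  rw [hookOff, sum_range_succ, Nat.div_add_mod' u t]

/-- The block cells of a block label fit into its row of length `i`. [cite:
BurgisserIkenmeyerPanovaJAMS2019, Prop. 7.3 (proof)] -/
theorem hookOff_add_hookMul_le (ht : 0 < t) {u : ℕ} (hu : u < hookK t E) :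
    hookOff t u + hookMul t u ≤ hookI t E := by
  rw [hookOff_add_hookMul, ← sum_hookMul_row ht E (u % t) (Nat.mod_lt u ht)]
  apply Finset.sum_le_sum_of_subset (range_subset_range.mpr _)
  unfold hookK at hu
  exact (Nat.div_lt_iff_lt_mul ht).mpr hu

/-- In a block row, the cells of a label on an earlier layer come before those of a later layer.
[cite: BurgisserIkenmeyerPanovaJAMS2019, Prop. 7.3 (proof)] -/
theorem hookOff_add_hookMul_le_hookOff {u u' : ℕ} (hmod : u % t = u' % t)
    (hdiv : u / t < u' / t) : hookOff t u + hookMul t u ≤ hookOff t u' := by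
  rw [hookOff_add_hookMul, hookOff, hmod]
  exact Finset.sum_le_sum_of_subset (range_subset_range.mpr hdiv)

/-- The rows of `(r+1) × 1 + (t+1) × i + 1 × j ⊢ D`: `D - r - t i`, then `[a ≤ r] + i [a ≤ t]` for the
row `a ≥ 1`. [cite: BurgisserIkenmeyerPanovaJAMS2019, Thm. 6.2] -/
theorem hookRows_succ_succ (r t i D a : ℕ) : hookRows (r + 1) (t + 1) i D a =
    if a = 0 then D - r - t * i else (if a ≤ r then 1 else 0) + (if a ≤ t then i else 0) := by
  unfold hookRows
  simp only [Nat.add_sub_cancel, Nat.lt_succ_iff]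

/-- Membership in the Young diagram of the hook-like shape `b × 1 + c × i + 1 × j` is governed by
`hookRows`. [cite: BurgisserIkenmeyerPanovaJAMS2019, Thm. 6.2] -/
theorem mem_youngDiagram_hookPartition {b c i D : ℕ} (hb : 0 < b) (hc : 0 < c) (h : b + c * i ≤ D)
    (a y : ℕ) : (a, y) ∈ (hookPartition b c i D).youngDiagram ↔ y < hookRows b c i D a := by
  rw [YoungDiagram.mem_iff_lt_rowLen, Literature.NumberTheory.DiophantineGeometry.rowLen_youngDiagram, hookPartition,
    getD_sortedParts_partitionOfRows (antitone_hookRows hb hc h) (sum_range_hookRows hb hc h)]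
  split_ifs with hlt
  · rfl
  · rw [hookRows_eq_zero hb (not_lt.mp hlt)]

/-- The row lengths of the Young diagram of the hook-like shape are `hookRows`. [cite:
BurgisserIkenmeyerPanovaJAMS2019, Thm. 6.2] -/
theorem rowLen_youngDiagram_hookPartition {b c i D : ℕ} (hb : 0 < b) (hc : 0 < c) (h : b + c * i ≤ D)
    (a : ℕ) : (hookPartition b c i D).youngDiagram.rowLen a = hookRows b c i D a :=
  YoungDiagram.rowLen_eq_of_forall_mem_iff fun y => mem_youngDiagram_hookPartition hb hc h a y

variable (ht : 0 < t) (hr₀ : 0 < r) (hr : r ≤ hookK t E) (hd : hookK t E + hookI t E + 1 ≤ d)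
  (hn : 2 * hookK t E + 1 ≤ n)
include ht hr hd hn

/-- The parameters of the cell map make `(r+1) × 1 + (t+1) × i + 1 × j ⊢ d n` a genuine hook-like
shape: `(r + 1) + (t + 1) i ≤ d n`. [cite: BurgisserIkenmeyerPanovaJAMS2019, Prop. 7.3 (proof)] -/
theorem hookShape_le : r + 1 + (t + 1) * hookI t E ≤ d * n := by
  have := hookP_eq ht hr hd hn
  nlinarith

/-- **The cell map lands in the shape** (`u < d`, `ν < n`): block cells fit into their rows
(`hookOff_add_hookMul_le`), hanging cells into the first column (`u < r`), first-row cells into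
the first row (`hookP_eq`). [cite: BurgisserIkenmeyerPanovaJAMS2019, Prop. 7.3 (proof)] -/
theorem hookCell_mem {u ν : ℕ} (hu : u < d) (hν : ν < n) :
    hookCell t r E n u ν ∈ (hookPartition (r + 1) (t + 1) (hookI t E) (d * n)).youngDiagram := by
  have hP := hookP_eq ht hr hd hn
  have key0 : ∀ y : ℕ, (0, y) ∈ (hookPartition (r + 1) (t + 1) (hookI t E) (d * n)).youngDiagram ↔
      y < d * n - r - t * hookI t E := fun y => by
    rw [mem_youngDiagram_hookPartition (Nat.succ_pos r) (Nat.succ_pos t) (hookShape_le ht hr hd hn),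
      hookRows_succ_succ, if_pos rfl]
  have keyS : ∀ a y : ℕ, (a + 1, y) ∈ (hookPartition (r + 1) (t + 1) (hookI t E) (d * n)).youngDiagram ↔
      y < (if a < r then 1 else 0) + (if a < t then hookI t E else 0) := fun a y => by
    rw [mem_youngDiagram_hookPartition (Nat.succ_pos r) (Nat.succ_pos t) (hookShape_le ht hr hd hn),
      hookRows_succ_succ, if_neg (Nat.succ_ne_zero a)]
    simp only [Nat.add_one_le_iff]
  unfold hookCell
  by_cases h1 : ν < hookQ t r E u
  · rw [if_pos h1]
    by_cases h2 : u < hookK t E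
    · rw [if_pos h2]
      by_cases h3 : ν < hookMul t u
      · rw [if_pos h3, keyS, if_pos (Nat.mod_lt u ht)]
        have hoff := hookOff_add_hookMul_le ht h2
        by_cases h4 : u % t < r
        · rw [if_pos h4]; omega
        · rw [if_neg h4]; omega
      · rw [if_neg h3, keyS]
        have h4 : u < r := by
          by_contra h4
          rw [hookQ_eq_hookMul h2 (not_lt.mp h4)] at h1
          exact h3 h1
        rw [if_pos h4]
        omega
    · rw [if_neg h2, key0]
      have := le_of_hookQ_pos (lt_of_le_of_lt (Nat.zero_le ν) h1)
      omega
  · rw [if_neg h1, key0]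
    have := hookP_succ_le (t := t) (r := r) (E := E) (n := n) hu
    omega

omit ht hr hd hn in
/-- **The cell map is injective** on `ν, ν' < n`: different regions are separated by the row (`0` or
not) and the column (`0`, `≤ i`, `> i`); inside a block row the layers occupy disjoint column
intervals (`hookOff_add_hookMul_le_hookOff`), and the singleton cells of different labels disjoint
intervals (`hookP_succ_le`). [cite: BurgisserIkenmeyerPanovaJAMS2019, Prop. 7.3 (proof)] -/
theorem hookCell_injective {u ν u' ν' : ℕ} (hν : ν < n) (hν' : ν' < n)
    (h : hookCell t r E n u ν = hookCell t r E n u' ν') : u = u' ∧ ν = ν' := by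
  -- a general principle for the two asymmetric comparisons
  unfold hookCell at h
  by_cases h1 : ν < hookQ t r E u <;> by_cases h1' : ν' < hookQ t r E u' <;>
    simp only [h1, h1', if_true, if_false] at h
  · -- structured / structured
    by_cases h2 : u < hookK t E <;> by_cases h2' : u' < hookK t E <;>
      simp only [h2, h2', if_true, if_false] at h
    · by_cases h3 : ν < hookMul t u <;> by_cases h3' : ν' < hookMul t u' <;>
        simp only [h3, h3', if_true, if_false, Prod.mk.injEq] at h
      · -- block / block
        obtain ⟨hrow, hcol⟩ := h
        have hmod : u % t = u' % t := by omega
        rw [hmod] at hcol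
        rcases lt_trichotomy (u / t) (u' / t) with hlt | heq | hgt
        · have := hookOff_add_hookMul_le_hookOff hmod hlt; omega
        · have hu : u = u' := by rw [← Nat.div_add_mod u t, ← Nat.div_add_mod u' t, heq, hmod]
          subst hu
          exact ⟨rfl, by omega⟩
        · have := hookOff_add_hookMul_le_hookOff hmod.symm hgt; omega
      · -- block / hanging
        exfalso
        obtain ⟨hrow, hcol⟩ := h
        have h4 : u' < r := by
          by_contra h4; rw [hookQ_eq_hookMul h2' (not_lt.mp h4)] at h1'; exact h3' h1'
        have : u % t < r := by omega
        rw [if_pos this] at hcol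
        omega
      · exfalso
        obtain ⟨hrow, hcol⟩ := h
        have h4 : u < r := by
          by_contra h4; rw [hookQ_eq_hookMul h2 (not_lt.mp h4)] at h1; exact h3 h1
        have : u' % t < r := by omega
        rw [if_pos this] at hcol
        omega
      · -- hanging / hanging
        have hu : u = u' := by omega
        subst hu
        have := hookQ_le_hookMul_add_one (r := r) h2
        exact ⟨rfl, by omega⟩
    · exfalso; split_ifs at h <;> simp only [Prod.mk.injEq] at h <;> omega
    · exfalso; split_ifs at h <;> simp only [Prod.mk.injEq] at h <;> omega
    · simp only [Prod.mk.injEq, true_and] at h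
      have hq := hookQ_le_one (r := r) (not_lt.mp h2)
      have hq' := hookQ_le_one (r := r) (not_lt.mp h2')
      exact ⟨by omega, by omega⟩
  · exfalso
    by_cases h2 : u < hookK t E
    · rw [if_pos h2] at h
      by_cases h3 : ν < hookMul t u
      · rw [if_pos h3, Prod.mk.injEq] at h; omega
      · rw [if_neg h3, Prod.mk.injEq] at h; omega
    · rw [if_neg h2, Prod.mk.injEq] at h
      have := le_of_hookQ_pos (lt_of_le_of_lt (Nat.zero_le ν) h1)
      omega
  · exfalso
    by_cases h2 : u' < hookK t E
    · rw [if_pos h2] at h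
      by_cases h3 : ν' < hookMul t u'
      · rw [if_pos h3, Prod.mk.injEq] at h; omega
      · rw [if_neg h3, Prod.mk.injEq] at h; omega
    · rw [if_neg h2, Prod.mk.injEq] at h
      have := le_of_hookQ_pos (lt_of_le_of_lt (Nat.zero_le ν') h1')
      omega
  · -- singleton / singleton
    simp only [Prod.mk.injEq] at h
    rcases lt_trichotomy u u' with hlt | rfl | hgt
    · have := hookP_succ_le (t := t) (r := r) (E := E) (n := n) hlt; omega
    · exact ⟨rfl, by omega⟩
    · have := hookP_succ_le (t := t) (r := r) (E := E) (n := n) hgt; omega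

end Cells

end Literature.Computability.Complexity

/-! ### 3. The labelling of the cells and its row rigidity -/

namespace Literature.Computability.Complexity

open Finset AlgebraicComplexity AlgebraicComplexity.ContentTableau

section Shape

variable {t r E n d : ℕ}

/-- The block cells of a block label. [cite: BurgisserIkenmeyerPanovaJAMS2019, Prop. 7.3 (proof)] -/
theorem hookCell_block {u ν : ℕ} (hQ : ν < hookQ t r E u) (hu : u < hookK t E) (hν : ν < hookMul t u) :
    hookCell t r E n u ν = (u % t + 1, (if u % t < r then 1 else 0) + hookOff t u + ν) := by
  unfold hookCell; rw [if_pos hQ, if_pos hu, if_pos hν]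

/-- The hanging cell of a block label. [cite: BurgisserIkenmeyerPanovaJAMS2019, Prop. 7.3 (proof)] -/
theorem hookCell_hanging {u ν : ℕ} (hQ : ν < hookQ t r E u) (hu : u < hookK t E) (hν : ¬ ν < hookMul t u) :
    hookCell t r E n u ν = (u + 1, 0) := by
  unfold hookCell; rw [if_pos hQ, if_pos hu, if_neg hν]

/-- Only the block labels `u < r` hang. [cite: BurgisserIkenmeyerPanovaJAMS2019, Prop. 7.3 (proof)] -/
theorem lt_r_of_hanging {u ν : ℕ} (hQ : ν < hookQ t r E u) (hu : u < hookK t E) (hν : ¬ ν < hookMul t u) :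
    u < r := by
  by_contra h4
  rw [hookQ_eq_hookMul hu (not_lt.mp h4)] at hQ
  exact hν hQ

/-- The first-row structured cell of a first-row label. [cite: BurgisserIkenmeyerPanovaJAMS2019, Prop.
7.3 (proof)] -/
theorem hookCell_rowZero {u ν : ℕ} (hQ : ν < hookQ t r E u) (hu : ¬ u < hookK t E) :
    hookCell t r E n u ν = (0, u - hookK t E) := by
  unfold hookCell; rw [if_pos hQ, if_neg hu]

/-- The singleton cells. [cite: BurgisserIkenmeyerPanovaJAMS2019, Prop. 7.3 (proof)] -/
theorem hookCell_singleton {u ν : ℕ} (hQ : ¬ ν < hookQ t r E u) :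
    hookCell t r E n u ν = (0, hookI t E + 1 + hookP t r E n u + (ν - hookQ t r E u)) := by
  unfold hookCell; rw [if_neg hQ]

/-- **The cells below the first row are exactly the structured cells of the block labels** (BIP: the
labels `u ≤ D` are those of the subtableau below row 1). [cite: BurgisserIkenmeyerPanovaJAMS2019,
Claim 7.1 and Prop. 7.3 (proof)] -/
theorem fst_hookCell_ne_zero_iff {u ν : ℕ} :
    (hookCell t r E n u ν).1 ≠ 0 ↔ ν < hookQ t r E u ∧ u < hookK t E := by
  constructor
  · intro h
    by_cases hQ : ν < hookQ t r E u
    · by_cases hu : u < hookK t E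
      · exact ⟨hQ, hu⟩
      · rw [hookCell_rowZero hQ hu] at h; exact absurd rfl h
    · rw [hookCell_singleton hQ] at h; exact absurd rfl h
  · rintro ⟨hQ, hu⟩
    by_cases hν : ν < hookMul t u
    · rw [hookCell_block hQ hu hν]; exact Nat.succ_ne_zero _
    · rw [hookCell_hanging hQ hu hν]; exact Nat.succ_ne_zero _

/-- **The structured cells are exactly the cells of the non-singleton columns `≤ i`** (the singleton
columns of the first row are the columns `> i = λ₂ - 1`). [cite: BurgisserIkenmeyerPanovaJAMS2019,
Prop. 7.3 (proof)] -/
theorem snd_hookCell_lt_iff (ht : 0 < t) {u ν : ℕ} :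
    (hookCell t r E n u ν).2 < hookI t E + 1 ↔ ν < hookQ t r E u := by
  constructor
  · intro h
    by_contra hQ
    rw [hookCell_singleton hQ] at h
    simp only at h
    omega
  · intro hQ
    by_cases hu : u < hookK t E
    · by_cases hν : ν < hookMul t u
      · rw [hookCell_block hQ hu hν]
        have := hookOff_add_hookMul_le ht hu
        split_ifs <;> simp only <;> omega
      · rw [hookCell_hanging hQ hu hν]; simp only; omega
    · rw [hookCell_rowZero hQ hu]
      have := le_of_hookQ_pos (lt_of_le_of_lt (Nat.zero_le ν) hQ)
      simp only; omega

/-- **The block labels are told apart by their numbers of structured cells** (BIP: "the crucial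
observation is again that the labels of `T` below row 1 all appear a different number of times";
here: the multiplicities `x_u` are distinct and even, and a hanging cell adds one). [cite:
BurgisserIkenmeyerPanovaJAMS2019, Prop. 7.3 (proof)] -/
theorem hookQ_injOn (ht : 0 < t) {u v : ℕ} (hu : u < hookK t E) (hv : v < hookK t E)
    (h : hookQ t r E u = hookQ t r E v) : u = v := by
  rw [hookQ_of_lt hu, hookQ_of_lt hv] at h
  unfold hookMul at h
  apply hookZig_injective ht
  split_ifs at h <;> omega

end Shape

section Labelling

variable {t r E n d : ℕ} (ht : 0 < t) (hr₀ : 0 < r) (hr : r ≤ hookK t E)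
  (hd : hookK t E + hookI t E + 1 ≤ d) (hn : 2 * hookK t E + 1 ≤ n)
include ht hr₀ hr hd hn

omit hr₀ in
/-- **The content tableau as a labelling of the cells.** The cell map is a bijection from `[0,d) ×
[0,n)` onto the cells of the shape (injective between sets of the same size `d n`,
`Nat.Partition.card_cells_youngDiagram`), so its inverse followed by the first projection labels
the cells of `(r+1) × 1 + (t+1) × i + 1 × j ⊢ d n` by `Fin d`, the label `u` sitting exactly on
the cells `hookCell u ν`, `ν < n` — a tableau of this shape "filled with the labels `1, …, d`,
each number appearing `n` times". [cite: BurgisserIkenmeyerPanovaJAMS2019, Prop. 7.3 (proof)] -/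
theorem exists_hookLabelling : ∃ L : ℕ × ℕ → Fin d,
    (∀ (u : Fin d) (ν : ℕ), ν < n → L (hookCell t r E n u ν) = u) ∧
    (∀ c ∈ (hookPartition (r + 1) (t + 1) (hookI t E) (d * n)).youngDiagram.cells,
      ∃ ν < n, c = hookCell t r E n (L c) ν) := by
  classical
  set Y := (hookPartition (r + 1) (t + 1) (hookI t E) (d * n)).youngDiagram with hY
  have hdpos : 0 < d := by omega
  set Φ : Fin d × Fin n → Y.cells := fun p =>
    ⟨hookCell t r E n p.1 p.2, (YoungDiagram.mem_cells _).2 (hookCell_mem ht hr hd hn p.1.2 p.2.2)⟩ with hΦ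
  have hinj : Function.Injective Φ := by
    rintro ⟨u, ν⟩ ⟨u', ν'⟩ h
    have h' : hookCell t r E n u ν = hookCell t r E n u' ν' := congrArg Subtype.val h
    obtain ⟨h1, h2⟩ := hookCell_injective ν.2 ν'.2 h'
    exact Prod.ext (Fin.ext h1) (Fin.ext h2)
  have hbij : Function.Bijective Φ := by
    rw [Fintype.bijective_iff_injective_and_card]
    refine ⟨hinj, ?_⟩
    rw [Fintype.card_prod, Fintype.card_fin, Fintype.card_fin, Fintype.card_coe,
      Nat.Partition.card_cells_youngDiagram]
  set e := Equiv.ofBijective Φ hbij with he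
  refine ⟨fun c => if h : c ∈ Y.cells then (e.symm ⟨c, h⟩).1 else ⟨0, hdpos⟩, ?_, ?_⟩
  · intro u ν hν
    have hmem : hookCell t r E n u ν ∈ Y.cells :=
      (YoungDiagram.mem_cells _).2 (hookCell_mem ht hr hd hn u.2 hν)
    simp only [dif_pos hmem]
    have : e.symm ⟨hookCell t r E n u ν, hmem⟩ = (u, ⟨ν, hν⟩) := by
      rw [Equiv.symm_apply_eq]; rfl
    rw [this]
  · intro c hc
    simp only [dif_pos hc]
    refine ⟨(e.symm ⟨c, hc⟩).2, (e.symm ⟨c, hc⟩).2.2, ?_⟩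
    have h1 : e (e.symm ⟨c, hc⟩) = ⟨c, hc⟩ := e.apply_symm_apply _
    exact (congrArg Subtype.val h1).symm

variable {L : ℕ × ℕ → Fin d}
  (hL₁ : ∀ (u : Fin d) (ν : ℕ), ν < n → L (hookCell t r E n u ν) = u)
  (hL₂ : ∀ c ∈ (hookPartition (r + 1) (t + 1) (hookI t E) (d * n)).youngDiagram.cells,
      ∃ ν < n, c = hookCell t r E n (L c) ν)
include hL₁ hL₂

omit hr₀ in
/-- The class `C_u` of the label `u` is the set of cells `hookCell u ν`, `ν < n`. [cite:
BurgisserIkenmeyerPanovaJAMS2019, Prop. 7.3 (proof)] -/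
theorem cellsOf_hookLabelling (u : Fin d) :
    cellsOf (hookPartition (r + 1) (t + 1) (hookI t E) (d * n)).youngDiagram L u =
      (range n).image (hookCell t r E n u) := by
  ext c
  simp only [cellsOf, mem_filter, mem_image, mem_range, YoungDiagram.mem_cells]
  constructor
  · rintro ⟨hc, rfl⟩
    obtain ⟨ν, hν, hcν⟩ := hL₂ c ((YoungDiagram.mem_cells _).2 hc)
    exact ⟨ν, hν, hcν.symm⟩
  · rintro ⟨ν, hν, rfl⟩
    exact ⟨hookCell_mem ht hr hd hn u.2 hν, hL₁ u ν hν⟩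

omit hr₀ in
/-- **Content `d × n`**: every class has exactly `n` cells. [cite: BurgisserIkenmeyerPanovaJAMS2019,
Prop. 7.3 (proof)] -/
theorem card_cellsOf_hookLabelling (u : Fin d) :
    (cellsOf (hookPartition (r + 1) (t + 1) (hookI t E) (d * n)).youngDiagram L u).card = n := by
  rw [cellsOf_hookLabelling ht hr hd hn hL₁ hL₂, card_image_of_injOn, card_range]
  intro ν hν ν' hν' h
  exact (hookCell_injective (mem_range.mp hν) (mem_range.mp hν') h).2

/-- The cells of `C_u` in the non-singleton columns are the structured cells `hookCell u ν`, `ν <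
hookQ u`. [cite: BurgisserIkenmeyerPanovaJAMS2019, Prop. 7.3 (proof)] -/
theorem nonsingletonCellsOf_hookLabelling (u : Fin d) :
    nonsingletonCellsOf (hookPartition (r + 1) (t + 1) (hookI t E) (d * n)).youngDiagram L u =
      (range (hookQ t r E u)).image (hookCell t r E n u) := by
  have hrow : (hookPartition (r + 1) (t + 1) (hookI t E) (d * n)).youngDiagram.rowLen 1 = hookI t E + 1 := by
    rw [rowLen_youngDiagram_hookPartition (Nat.succ_pos r) (Nat.succ_pos t) (hookShape_le ht hr hd hn),
      hookRows_succ_succ, if_neg Nat.one_ne_zero]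
    split_ifs <;> omega
  ext c
  simp only [nonsingletonCellsOf, mem_filter, mem_image, mem_range, YoungDiagram.mem_cells, hrow]
  constructor
  · rintro ⟨hc, rfl, hcol⟩
    obtain ⟨ν, hν, hcν⟩ := hL₂ c ((YoungDiagram.mem_cells _).2 hc)
    refine ⟨ν, ?_, hcν.symm⟩
    rw [hcν] at hcol
    exact (snd_hookCell_lt_iff ht).mp hcol
  · rintro ⟨ν, hν, rfl⟩
    have hνn : ν < n := lt_of_lt_of_le hν ((hookQ_le ht _).trans hn)
    exact ⟨hookCell_mem ht hr hd hn u.2 hνn, hL₁ u ν hνn, (snd_hookCell_lt_iff ht).mpr hν⟩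

/-- `|C_u ∖ C_u^1| = hookQ u`. [cite: BurgisserIkenmeyerPanovaJAMS2019, Prop. 7.3 (proof)] -/
theorem card_nonsingletonCellsOf_hookLabelling (u : Fin d) :
    (nonsingletonCellsOf (hookPartition (r + 1) (t + 1) (hookI t E) (d * n)).youngDiagram L u).card =
      hookQ t r E u := by
  rw [nonsingletonCellsOf_hookLabelling ht hr₀ hr hd hn hL₁ hL₂, card_image_of_injOn, card_range]
  intro ν hν ν' hν' h
  have hQ := (hookQ_le ht (r := r) (E := E) (u : ℕ)).trans hn
  exact (hookCell_injective (lt_of_lt_of_le (mem_range.mp hν) hQ)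
    (lt_of_lt_of_le (mem_range.mp hν') hQ) h).2

/-- `|C_u^1| = n - hookQ u` (BIP: `|C_u^1| = n - β(u)`). [cite: BurgisserIkenmeyerPanovaJAMS2019,
Prop. 7.3 (proof)] -/
theorem card_singletonCellsOf_hookLabelling (u : Fin d) :
    (singletonCellsOf (hookPartition (r + 1) (t + 1) (hookI t E) (d * n)).youngDiagram L u).card =
      n - hookQ t r E u := by
  have h := card_nonsingletonCellsOf_add_card_singletonCellsOf
    (Y := (hookPartition (r + 1) (t + 1) (hookI t E) (d * n)).youngDiagram) (lab := L) u
  rw [card_cellsOf_hookLabelling ht hr hd hn hL₁ hL₂, card_nonsingletonCellsOf_hookLabelling ht hr₀ hr hd hn hL₁ hL₂] at h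
  omega

/-- The labels with a cell below the first row are exactly the block labels `u < K` (BIP's `u ≤ D`).
[cite: BurgisserIkenmeyerPanovaJAMS2019, Claim 7.1 and Prop. 7.3 (proof)] -/
theorem hasLowCell_hookLabelling_iff (u : Fin d) :
    HasLowCell (hookPartition (r + 1) (t + 1) (hookI t E) (d * n)).youngDiagram L u ↔ (u : ℕ) < hookK t E := by
  constructor
  · rintro ⟨c, hc, rfl, hc1⟩
    obtain ⟨ν, hν, hcν⟩ := hL₂ c hc
    rw [hcν] at hc1
    exact (fst_hookCell_ne_zero_iff.mp hc1).2
  · intro hu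
    have hQ : 0 < hookQ t r E u := lt_of_lt_of_le (by norm_num) (two_le_hookQ (r := r) hu)
    have hn0 : 0 < n := by omega
    refine ⟨hookCell t r E n u 0, (YoungDiagram.mem_cells _).2 (hookCell_mem ht hr hd hn u.2 hn0),
      hL₁ u 0 hn0, fst_hookCell_ne_zero_iff.mpr ⟨hQ, hu⟩⟩

/-- **Row rigidity of the content tableau of the hook-like shape**: every class-preserving, weakly
column-regular permutation of the cells preserves rows — the hypotheses (S0), (S1), (S3), (S4) of
the abstract Claim 7.1 (`CplxAlg.fst_perm_eq_fst`) hold: non-block labels have at most one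
structured cell (`hookQ_le_one`), block labels at least two, all below the first row
(`two_le_hookQ`, `fst_hookCell_ne_zero_iff`), block labels are separated by `|C_u^1|`
(`hookQ_injOn`), and the structured cells of a block label lie in its block row `u % t + 1` and,
if it hangs below the block (`t ≤ u < r`), in the row `u + 1`, whose only cell is in the first
column while the block cells of the rows `≤ r` are not. This is BIP's "all nonzero summands in
(4.3) have the value 1" for the (corrected) tableau of Prop. 7.3. [cite:
BurgisserIkenmeyerPanovaJAMS2019, Claim 7.1 and Prop. 7.3 (proof)] -/
theorem rowRigid_hookLabelling (τ' : Equiv.Perm (hookPartition (r + 1) (t + 1) (hookI t E) (d * n)).youngDiagram.cells)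
    (hcls : ∀ c c' : (hookPartition (r + 1) (t + 1) (hookI t E) (d * n)).youngDiagram.cells,
      L (τ' c) = L (τ' c') ↔ L c = L c')
    (hCR : ∀ c : (hookPartition (r + 1) (t + 1) (hookI t E) (d * n)).youngDiagram.cells,
      (((τ' c : (hookPartition (r + 1) (t + 1) (hookI t E) (d * n)).youngDiagram.cells) : ℕ × ℕ).1,
        (c : ℕ × ℕ).2) ∈ (hookPartition (r + 1) (t + 1) (hookI t E) (d * n)).youngDiagram) :
    ∀ c : (hookPartition (r + 1) (t + 1) (hookI t E) (d * n)).youngDiagram.cells,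
      ((τ' c : (hookPartition (r + 1) (t + 1) (hookI t E) (d * n)).youngDiagram.cells) : ℕ × ℕ).1 =
        (c : ℕ × ℕ).1 := by
  have hns := nonsingletonCellsOf_hookLabelling ht hr₀ hr hd hn hL₁ hL₂
  have hlow := hasLowCell_hookLabelling_iff ht hr₀ hr hd hn hL₁ hL₂
  refine fst_perm_eq_fst (n := n) ?_ ?_ ?_ ?_ ?_ τ' hcls hCR
  · intro c _
    exact card_cellsOf_hookLabelling ht hr hd hn hL₁ hL₂ (L c)
  · intro u hu
    rw [card_nonsingletonCellsOf_hookLabelling ht hr₀ hr hd hn hL₁ hL₂]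
    exact hookQ_le_one (not_lt.mp ((not_congr (hlow u)).mp hu))
  · intro u hu
    have hu' := (hlow u).mp hu
    refine ⟨fun c hc => ?_, ?_⟩
    · rw [hns, mem_image] at hc
      obtain ⟨ν, hν, rfl⟩ := hc
      exact fst_hookCell_ne_zero_iff.mpr ⟨mem_range.mp hν, hu'⟩
    · rw [card_nonsingletonCellsOf_hookLabelling ht hr₀ hr hd hn hL₁ hL₂]
      exact two_le_hookQ hu'
  · intro u v hu hv h
    rw [card_singletonCellsOf_hookLabelling ht hr₀ hr hd hn hL₁ hL₂,
      card_singletonCellsOf_hookLabelling ht hr₀ hr hd hn hL₁ hL₂] at h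
    have hu' := (hlow u).mp hu
    have hv' := (hlow v).mp hv
    have hQu := (hookQ_le ht (r := r) (E := E) (u : ℕ)).trans hn
    have hQv := (hookQ_le ht (r := r) (E := E) (v : ℕ)).trans hn
    exact Fin.ext (hookQ_injOn (r := r) ht hu' hv' (by omega))
  · intro u hu
    have hu' := (hlow u).mp hu
    refine ⟨(u : ℕ) % t + 1, if (u : ℕ) < r then (u : ℕ) + 1 else (u : ℕ) % t + 1, ?_, ?_, ?_⟩
    · split_ifs
      · exact Nat.succ_le_succ (Nat.mod_le _ _)
      · exact le_rfl
    · intro c hc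
      rw [hns, mem_image] at hc
      obtain ⟨ν, hν, rfl⟩ := hc
      rw [mem_range] at hν
      by_cases hνx : ν < hookMul t u
      · left; rw [hookCell_block hν hu' hνx]
      · right
        rw [hookCell_hanging hν hu' hνx, if_pos (lt_r_of_hanging hν hu' hνx)]
    · intro hab c hc hca
      rw [hns, mem_image] at hc
      obtain ⟨ν, hν, rfl⟩ := hc
      rw [mem_range] at hν
      have hur : (u : ℕ) < r := by
        by_contra hur; rw [if_neg hur] at hab; exact lt_irrefl _ hab
      rw [if_pos hur] at hab ⊢
      have hνx : ν < hookMul t u := by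
        by_contra hνx
        rw [hookCell_hanging hν hu' hνx] at hca
        simp only at hca
        omega
      rw [hookCell_block hν hu' hνx, if_pos (lt_of_le_of_lt (Nat.mod_le _ _) hur)]
      simp only
      rw [mem_youngDiagram_hookPartition (Nat.succ_pos r) (Nat.succ_pos t) (hookShape_le ht hr hd hn),
        hookRows_succ_succ, if_neg (Nat.succ_ne_zero _)]
      have hut : ¬ (u : ℕ) + 1 ≤ t := by
        intro hut
        have : (u : ℕ) % t = u := Nat.mod_eq_of_lt hut
        omega
      rw [if_neg hut]
      split_ifs <;> omega

end Labelling

end Literature.Computability.Complexity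

/-! ### 4. Positivity of the plethysm coefficients of the hook-like shapes, and BIP Thm. 6.2 -/

namespace Literature.Computability.Complexity

open Finset MvPolynomial

section Positivity

variable {t r E n d : ℕ}

/-- **`a_ν(d[n]) > 0` for the hook-like shapes, word model**: for `t, r ≥ 1`, `E` with `r ≤ K = 2Et`,
`d ≥ K + i + 1` labels, `n ≥ 2K + 1` letters per label and an alphabet with at least `max r t + 1
= ℓ(ν)` letters, there is a nonzero `S_d ≀ S_n`-invariant highest-weight vector of weight `ν =
(r+1) × 1 + (t+1) × i + 1 × j ⊢ d n`, `i = 2E(2Et+1)`, in `(k^N)^{⊗ d n}` — the tableau vector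
`v_T` of the row-rigid content tableau (`CplxAlg.exists_wreathInvariant_hwv`, the method of BIP §7
with Thm. 4.7). Compared with the printed Prop. 7.3 (`i` in a window above `(r+2t)²/2t`, `n > 6t +
2r`, `d > r + 2t + i`, reduction to `n = te + 2`, `d = te + i + 1` by the liftings of §5) the
multiplicities are doubled, `i` is the specific even value `2E(2Et+1)`, and no lifting is needed:
surplus labels and surplus letters are absorbed by singleton cells of the first row. [cite:
BurgisserIkenmeyerPanovaJAMS2019, Prop. 7.3 (proof) and Thm. 4.7] -/
theorem exists_wreathInvariant_hwv_hook {k : Type*} [Field k] [CharZero k] {N : ℕ} (ht : 0 < t)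
    (hr₀ : 0 < r) (hr : r ≤ hookK t E) (hd : hookK t E + hookI t E + 1 ≤ d) (hn : 2 * hookK t E + 1 ≤ n)
    (hN : max r t + 1 ≤ N) :
    ∃ x : Literature.NumberTheory.DiophantineGeometry.Word N (d * n) → k,
      x ∈ Literature.NumberTheory.DiophantineGeometry.highestWeightSpace (Literature.NumberTheory.DiophantineGeometry.wordRep k N (d * n))
        (Literature.NumberTheory.DiophantineGeometry.Weight.ofPartition N (hookPartition (r + 1) (t + 1) (hookI t E) (d * n))) ∧
      x ≠ 0 ∧ ∀ τ ∈ AlgebraicComplexity.blockPerms d n, Literature.NumberTheory.DiophantineGeometry.wordPerm k τ x = x := by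
  obtain ⟨L, hL₁, hL₂⟩ := exists_hookLabelling ht hr hd hn
  have hsh := hookShape_le ht hr hd hn
  refine AlgebraicComplexity.exists_wreathInvariant_hwv _ ?_ L ?_ ?_
  · calc (hookPartition (r + 1) (t + 1) (hookI t E) (d * n)).parts.card ≤ max (r + 1) (t + 1) :=
          card_parts_partitionOfRows_le (antitone_hookRows (Nat.succ_pos r) (Nat.succ_pos t) hsh)
            (sum_range_hookRows (Nat.succ_pos r) (Nat.succ_pos t) hsh)
      _ ≤ N := by omega
  · intro u
    exact card_cellsOf_hookLabelling ht hr hd hn hL₁ hL₂ u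
  · exact rowRigid_hookLabelling ht hr₀ hr hd hn hL₁ hL₂

/-- **Positivity of the plethysm coefficients of the hook-like shapes, in the weight form of the
topic** (the format of the named fact `bip2019_prop_7_3` of `OccurrenceObstructionsHooks.lean`,
for the parameters of `exists_wreathInvariant_hwv_hook` and `V = ℂ^{N×N}` with `N² ≥ max r t +
1`): there is a NONZERO form of degree `d` on `Sym^n V^*` in the highest-weight space of weight
`ν^*`, `ν = hookPartition (r+1) (t+1) (2E(2Et+1)) (d n)` — the wreath-invariant vector read back
through the dictionary `CplxAlg.formOfWord` (`formOfWord_mem_highestWeightSpace`,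
`formOfWord_ne_zero`, order-reversing enumeration `revMatIdx`). A variant of BIP Prop. 7.3 ("Let
`ν = (t+1) × i + (r+1) × 1 + (j)` … Then `a_ν(d[n]) > 0`") with a specific even `i` and the
corrected tableau; the printed interval of admissible `i` is not reproduced. [cite:
BurgisserIkenmeyerPanovaJAMS2019, Prop. 7.3] -/
theorem exists_hwv_hookPartition (N : ℕ) (ht : 0 < t) (hr₀ : 0 < r) (hr : r ≤ hookK t E)
    (hd : hookK t E + hookI t E + 1 ≤ d) (hn : 2 * hookK t E + 1 ≤ n) (hN : max r t + 1 ≤ N * N) :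
    ∃ h : MvPolynomial (AlgebraicComplexity.DegIdx (Literature.NumberTheory.DiophantineGeometry.MatIdx N) n) ℂ, h ≠ 0 ∧ h.IsHomogeneous d ∧
      h ∈ Literature.NumberTheory.DiophantineGeometry.highestWeightSpace (AlgebraicComplexity.coordRep (Literature.NumberTheory.DiophantineGeometry.MatIdx N) ℂ n)
        (partitionWeightLex N (hookPartition (r + 1) (t + 1) (hookI t E) (d * n))) := by
  obtain ⟨x, hxw, hx0, hxinv⟩ :=
    exists_wreathInvariant_hwv_hook (k := ℂ) (N := N * N) ht hr₀ hr hd hn hN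
  refine ⟨AlgebraicComplexity.formOfWord (revMatIdx N) n d x, AlgebraicComplexity.formOfWord_ne_zero _ hxinv hx0,
    AlgebraicComplexity.isHomogeneous_formOfWord _ x,
    AlgebraicComplexity.formOfWord_mem_highestWeightSpace (strictAnti_revMatIdx N) hxinv ?_⟩
  have : (fun i => -(partitionWeightLex N (hookPartition (r + 1) (t + 1) (hookI t E) (d * n))) (revMatIdx N i)) =
      Literature.NumberTheory.DiophantineGeometry.Weight.ofPartition (N * N) (hookPartition (r + 1) (t + 1) (hookI t E) (d * n)) :=
    funext (neg_partitionWeightLex_revMatIdx N _)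
  rw [this]
  exact hxw

end Positivity

section Thm62

/-- **The parameters of the Proof of Theorem 6.2** ("We apply Proposition 7.3 with `r = b - 1 ≤ m² -
1` and `t = c - 1 ≤ m² - 1` … We can then find an even integer `i` … `⊆ [1, m⁴ + 2m²]` … `d := 3m⁴
> r + 2t + i`, `N := 8m² > 6t + 2r`"), for the variant: with `E = ⌊(r-1)/2t⌋ + 1` (BIP's `e/2`)
one has `r ≤ K ≤ r + 2t - 1`, hence `i = 2E(K+1) = K(K+1)/t ≤ 2M⁴` (from `(A + 2t - 1)(A + 2t) ≤
2(A+1)² t` for `1 ≤ t ≤ A = M² - 1`, `M ≥ 2`), `K + i + 1 ≤ 3M⁴` labels and `2K + 1 ≤ 8M²` letters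
suffice. [cite: BurgisserIkenmeyerPanovaJAMS2019, §7 (Proof of Theorem 6.2)] -/
theorem hook_params {M r t : ℕ} (hM : 2 ≤ M) (hr₀ : 0 < r) (hrM : r + 1 ≤ M ^ 2) (ht : 0 < t) (htM : t + 1 ≤ M ^ 2) :
    r ≤ hookK t ((r - 1) / (2 * t) + 1) ∧
    hookI t ((r - 1) / (2 * t) + 1) ≤ 2 * M ^ 4 ∧
    hookK t ((r - 1) / (2 * t) + 1) + hookI t ((r - 1) / (2 * t) + 1) + 1 ≤ 3 * M ^ 4 ∧
    2 * hookK t ((r - 1) / (2 * t) + 1) + 1 ≤ 8 * M ^ 2 := by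
  obtain ⟨r', rfl⟩ : ∃ r', r = r' + 1 := ⟨r - 1, by omega⟩
  simp only [Nat.add_sub_cancel]
  set q := r' / (2 * t) with hq
  set A := M ^ 2 - 1 with hA
  have hM2 : M ^ 2 = A + 1 := by
    have : 1 ≤ M ^ 2 := Nat.one_le_pow _ _ (by omega)
    omega
  have hA3 : 3 ≤ A := by
    have : 2 ^ 2 ≤ M ^ 2 := Nat.pow_le_pow_left hM 2
    omega
  have hM4 : M ^ 4 = (A + 1) * (A + 1) := by
    rw [show M ^ 4 = M ^ 2 * M ^ 2 by ring, hM2]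
  have hrA : r' + 1 ≤ A := by omega
  have htA : t ≤ A := by omega
  -- the block label count `K = 2t(q+1)` is between `r` and `r + 2t - 1`
  have hdm : 2 * t * q + r' % (2 * t) = r' := Nat.div_add_mod r' (2 * t)
  have hml := Nat.mod_lt r' (show 0 < 2 * t by omega)
  have hK : hookK t (q + 1) = 2 * t * q + 2 * t := by unfold hookK; ring
  have hK₁ : r' + 1 ≤ hookK t (q + 1) := by rw [hK]; omega
  have hK₂ : hookK t (q + 1) + 1 ≤ r' + 1 + 2 * t := by rw [hK]; omega
  -- `i t = K (K + 1)`
  have hI : hookI t (q + 1) * t = hookK t (q + 1) * (hookK t (q + 1) + 1) := by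
    unfold hookI hookK; ring
  obtain ⟨t', rfl⟩ : ∃ t', t = t' + 1 := ⟨t - 1, by omega⟩
  have hKB : hookK (t' + 1) (q + 1) ≤ A + 2 * t' + 1 := by omega
  have hprod : hookK (t' + 1) (q + 1) * (hookK (t' + 1) (q + 1) + 1) ≤ (A + 2 * t' + 1) * (A + 2 * t' + 2) :=
    Nat.mul_le_mul hKB (by omega)
  have hkey : (A + 2 * t' + 1) * (A + 2 * t' + 2) ≤ 2 * ((A + 1) * (A + 1)) * (t' + 1) := by
    have h4 : 2 * t' + 2 ≤ A * A := by nlinarith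
    nlinarith
  have hI' : hookI (t' + 1) (q + 1) ≤ 2 * M ^ 4 := by
    rw [hM4]
    have : hookI (t' + 1) (q + 1) * (t' + 1) ≤ 2 * ((A + 1) * (A + 1)) * (t' + 1) := by
      rw [hI]; exact hprod.trans hkey
    exact Nat.le_of_mul_le_mul_right this (Nat.succ_pos t')
  refine ⟨hK₁, hI', ?_, ?_⟩
  · have : hookK (t' + 1) (q + 1) + 1 ≤ M ^ 4 := by rw [hM4]; nlinarith
    omega
  · rw [hM2]; omega

/-- **Discharge of `bip2019_thm_6_2` — BIP Thm. 6.2 (the hook-like building blocks occur in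
`ℂ[Ω_m]`).** "Let `2 ≤ b, c ≤ m²` and let `n ≥ 24m⁶`. Then there exists an even `i ≤ 2m⁴`, such
that `λ = b × 1 + c × i + 1 × j` occurs in `ℂ[Ω_n]_{3m⁴}` for `j = 3m⁴ n - b - ic`." Proof as
printed at the end of §7 (and as in the tree's conditional `bip2019_thm_6_2_of_prop_7_3`, whose
lifting-and-evaluation half is repeated verbatim), with the positivity input supplied by
`exists_hwv_hookPartition` instead of the named fact `bip2019_prop_7_3`: `r = b - 1`, `t = c - 1`,
the even `i = 2E(2Et+1) ≤ 2M⁴` of `hook_params`, a nonzero highest-weight vector `f` of weight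
`ν^*` among the forms of degree `d = 3M⁴` on `Sym^{8M²} (ℂ^{m×m})^*`; its inner lifting `h =
innerLift f` to `Sym^m` has weight `λ^* = (ν♯dm)^*` (`CplxAlg.innerLift_mem_highestWeightSpace`,
Lemma 5.3; `partitionWeightLex_hookPartition_add_single`) and does not vanish at the padded power
sum `q = X^{m-8M²}(φ_1^{8M²} + ⋯ + φ_d^{8M²}) ∈ Ω_m` (Thm. 2.5, `m ≥ 24M⁶ = d · 8M²`; Prop. 3.2;
Thm. 5.4 / Lemma 5.2), so `λ` occurs in `ℂ[Ω_m]_{3M⁴}`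
(`CplxAlg.hasHighestWeight_orbitCoordRep_of_not_mem`). Letters: determinant size `m` (BIP's `n`),
parameter `M` (BIP's `m`). [cite: BurgisserIkenmeyerPanovaJAMS2019, Thm. 6.2 and §7 (Proof of
Theorem 6.2)] -/
theorem bip2019_thm_6_2_holds : bip2019_thm_6_2 := by
  intro m M b c _ hb hbM hc hcM hm
  classical
  have hm0 : m ≠ 0 := NeZero.ne m
  set iₘ := topMatIdx m with hiₘ'
  have hiₘ : ∀ i, i ≤ iₘ := le_topMatIdx m
  -- parameters `r = b - 1`, `t = c - 1`
  obtain ⟨r, rfl⟩ : ∃ r, b = r + 1 := ⟨b - 1, by omega⟩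
  obtain ⟨t, rfl⟩ : ∃ t, c = t + 1 := ⟨c - 1, by omega⟩
  have hr : 0 < r := by omega
  have ht : 0 < t := by omega
  have hM2 : 2 ≤ M := by
    by_contra hM
    have hM1 : M ≤ 1 := by omega
    have : M ^ 2 ≤ 1 ^ 2 := Nat.pow_le_pow_left hM1 2
    omega
  set E := (r - 1) / (2 * t) + 1 with hE
  obtain ⟨hrK, hI2, hd, hn'⟩ := hook_params hM2 hr hbM ht hcM
  set i := hookI t E with hi
  have hieven : Even i := ⟨E * (2 * E * t + 1), by rw [hi]; unfold hookI; ring⟩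
  refine ⟨i, hieven, hI2, ?_⟩
  -- positivity with `V = ℂ^{m×m}`, inner degree `8M²`, degree `3M⁴`
  have hMpos : 0 < M := by omega
  have hN : max r t + 1 ≤ m * m := by
    have h1 : max r t + 1 ≤ M ^ 2 := by omega
    have h2 : M ^ 2 ≤ 24 * M ^ 6 := by
      calc M ^ 2 ≤ M ^ 6 := Nat.pow_le_pow_right hMpos (by norm_num)
        _ ≤ 24 * M ^ 6 := Nat.le_mul_of_pos_left _ (by norm_num)
    exact h1.trans (h2.trans (hm.trans (Nat.le_mul_self m)))
  obtain ⟨f, hf0, hfd, hfw⟩ := exists_hwv_hookPartition (n := 8 * M ^ 2) (d := 3 * M ^ 4) m ht hr hrK hd hn' hN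
  -- lift from inner degree `8M²` to `m` (BIP §7, last paragraph; as in §6(a))
  have hprod : 8 * M ^ 2 * (3 * M ^ 4) = 24 * M ^ 6 := by ring
  have hn'dm : 8 * M ^ 2 * (3 * M ^ 4) ≤ m := hprod ▸ hm
  have hdpos : 0 < 3 * M ^ 4 := by positivity
  have hn'pos : 0 < 8 * M ^ 2 := by positivity
  have hn'm : 8 * M ^ 2 ≤ m := le_trans (Nat.le_mul_of_pos_right _ hdpos) hn'dm
  have hlift := AlgebraicComplexity.innerLift_mem_highestWeightSpace iₘ hiₘ hn'm hfd hfw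
  have hbc : r + 1 + (t + 1) * i ≤ 3 * M ^ 4 * (8 * M ^ 2) :=
    hookShape_le (E := E) ht hrK hd hn'
  have hDD : 3 * M ^ 4 * (8 * M ^ 2) ≤ 3 * M ^ 4 * m := Nat.mul_le_mul_left _ hn'm
  have hw := partitionWeightLex_hookPartition_add_single m (Nat.succ_pos r) (Nat.succ_pos t) hbc hDD
  have hsub : 3 * M ^ 4 * m - 3 * M ^ 4 * (8 * M ^ 2) = (m - 8 * M ^ 2) * (3 * M ^ 4) := by
    rw [Nat.sub_mul, Nat.mul_comm m, Nat.mul_comm (8 * M ^ 2)]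
  rw [hsub] at hw
  rw [hw] at hlift
  refine Complexity.hasHighestWeight_orbitCoordRep_of_not_mem (Literature.NumberTheory.DiophantineGeometry.detFormLex ℂ m) m hlift ?_
  -- nonvanishing on `Ω_m`: evaluate the lifted vector at a padded power sum
  obtain ⟨F, hF⟩ : ∃ F : MvPolynomial (AlgebraicComplexity.DegIdx (Literature.NumberTheory.DiophantineGeometry.MatIdx m) (8 * M ^ 2)) ℂ,
      F = aeval (fun e : AlgebraicComplexity.DegIdx (Literature.NumberTheory.DiophantineGeometry.MatIdx m) (8 * M ^ 2) =>
        C (((e.1 iₘ + (m - 8 * M ^ 2)).descFactorial (m - 8 * M ^ 2) : ℕ) : ℂ) * X e) f := ⟨_, rfl⟩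
  have hsupp := AlgebraicComplexity.support_aeval_C_mul_X
    (fun e : AlgebraicComplexity.DegIdx (Literature.NumberTheory.DiophantineGeometry.MatIdx m) (8 * M ^ 2) =>
      (((e.1 iₘ + (m - 8 * M ^ 2)).descFactorial (m - 8 * M ^ 2) : ℕ) : ℂ))
    (fun e => Nat.cast_ne_zero.mpr (AlgebraicComplexity.descFactorial_add_pos _ _).ne') f
  rw [← hF] at hsupp
  have hF0 : F ≠ 0 := by
    intro h0
    apply hf0
    rw [← support_eq_empty, ← hsupp, h0, support_zero]
  have hFdeg : F.totalDegree ≤ 3 * M ^ 4 :=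
    (totalDegree_le_of_support_subset hsupp.le).trans (hfd.totalDegree hf0).le
  obtain ⟨φ, hφ⟩ := AlgebraicComplexity.exists_aeval_formCoeff_sum_linearFormPow_ne_zero hn'pos F hF0 hFdeg
  obtain ⟨p, hp⟩ : ∃ p : MvPolynomial (Literature.NumberTheory.DiophantineGeometry.MatIdx m) ℂ,
      p = ∑ j, (∑ x, C (φ j x) * X x) ^ (8 * M ^ 2) := ⟨_, rfl⟩
  have hphom : p.IsHomogeneous (8 * M ^ 2) := by
    rw [hp]
    exact Complexity.isHomogeneous_sum_linearFormPow φ (8 * M ^ 2)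
  obtain ⟨q, hq⟩ : ∃ q : MvPolynomial (Literature.NumberTheory.DiophantineGeometry.MatIdx m) ℂ, q = X iₘ ^ (m - 8 * M ^ 2) * p :=
    ⟨_, rfl⟩
  have hqhom : q.IsHomogeneous m := by
    have := (isHomogeneous_X_pow (R := ℂ) iₘ (m - 8 * M ^ 2)).mul hphom
    rwa [Nat.sub_add_cancel hn'm, ← hq] at this
  have hqmem : q ∈ AlgebraicComplexity.orbitClosure (Literature.NumberTheory.DiophantineGeometry.detFormLex ℂ m) := by
    rw [hq, hp]
    exact Complexity.X_pow_mul_sum_linearFormPow_mem_orbitClosure_detFormLex (s := 8 * M ^ 2)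
      (r := 3 * M ^ 4) hn'dm iₘ φ
  have hvq : aeval (AlgebraicComplexity.formCoeff m q) (AlgebraicComplexity.innerLift iₘ (8 * M ^ 2) m f) ≠ 0 := by
    rw [AlgebraicComplexity.aeval_formCoeff_innerLift iₘ hqhom, hq,
      AlgebraicComplexity.aeval_formCoeff_iterPderiv_X_pow_mul iₘ (m - 8 * M ^ 2) hphom, ← hF, hp]
    exact hφ
  intro hvI
  exact hvq (Complexity.aeval_formCoeff_eq_zero_of_mem_orbitClosure_detFormLex hqmem hvI)

/-- **Discharge of `bip2019_prop_6_3` — BIP Prop. 6.3 (splitting into building blocks)**, now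
unconditional: the tree's `bip2019_prop_6_3_of_parts` (the printed splitting technique over the
monoid of occurring weights, semigroup property Lemma 2.2) fed with the discharged Prop. 2.3
(`bip2019_prop_2_3_holds`, Cayley's hyperdeterminant) and Thm. 6.2 (`bip2019_thm_6_2_holds`).
"Given a partition `λ` with `|λ| = nd` such that there exists `m ≥ 2` with `ℓ(λ) ≤ m²`, `m^{10} ≤
|λ̄| ≤ m d`, `n ≥ 24 m⁶`, and `d > 4 m⁶`. Then `λ` occurs in `ℂ[Ω_n]_d`." [cite:
BurgisserIkenmeyerPanovaJAMS2019, Prop. 6.3] -/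
theorem bip2019_prop_6_3_holds : bip2019_prop_6_3 :=
  bip2019_prop_6_3_of_parts bip2019_prop_2_3_holds bip2019_thm_6_2_holds

end Thm62

end Literature.Computability.Complexity
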